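import Summits.AtomisticToContinuum.FouriersLaw.Theorems.HonestZwanzigOpenChainGreenKuboKuboPairing

/-!
# `OpenChainGreenKubo` (stmt-AtomisticToContinuum-12696), KDN step 2: the Kundu–Dhar–Narayan identity
# `∫₀^∞ ∫ g (P_s J) dμ_T ds = ∫₀^∞ corr(J,J) / (N-1)`

Helper file (`--supports`) for the support item `HonestZwanzig.OpenChainGreenKubo`; sequel of `…KuboPairing.lean`.
For the pinned chain (all parameters `> 0`, `N ≥ 2`, `T > 0`), the equilibrium kernels `P_t = transitionKernel N T T t`,
`μ_T = gibbsMeasure N T`, `J = Σ_i j_i` and the KDN source `g = (γ/2)(p_0² - p_{N-1}²)`: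

  `∫_{(0,∞)} ∫ g · (P_s J) dμ_T ds = (∫_{(0,∞)} (∫ J (P_t J) dμ_T - μ_T(J)²) dt) / (N - 1)`   (`kdn_identity`),

hypothesis (KDN) of the reduction skeleton `openChainGreenKubo_of_star_of_cont_of_kdn`. This is Kundu–Dhar–Narayan's
conversion of the bath-imbalance/current correlation into the current autocorrelation (arXiv:0809.4543 p. 3, the
"`D_l`" step), done at the level of RESOLVENTS with the tree's `L²(μ_T)` theory of the equilibrium generator:
resolvent detailed balance (`pinnedChain_resolvent_detailed_balance`), the coboundary identity
`R_λ(LΨ) = λR_λΨ - Ψ` (`pinnedChain_resolvent_coboundary`) for the McLennan potential `Ψ` with `LΨ = J/((N-1)T²) + g/T²`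
(`pinnedChain_generator_mclennanPotential`), parity (`∫ JΨ dμ_T = 0`), and the Abel limits `λ → 0`
(`pinnedChain_abs_resolvent_sub_kubo_le`, `pinnedChain_abs_abelMean_sub_le`). No definitions.
-/

noncomputable section

open MeasureTheory ProbabilityTheory Filter Topology Set Function
open scoped NNReal ENNReal ContDiff BigOperators

namespace Summit.AtomisticToContinuum.FouriersLaw.Theorems.OpenChainGreenKubo

open Literature.MathematicalPhysics.KineticTheory.HeatConduction
open Literature.MathematicalPhysics.KineticTheory OscillatorChain
open Summit.AtomisticToContinuum.FouriersLaw.Theorems.OddSectorIrreversibility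
open Summit.AtomisticToContinuum.FouriersLaw.Theorems.OddSectorIrreversibility.Corrector
open Literature.Barriers.AtomisticToContinuum.OpenChain

variable {N : ℕ}

section KDN

variable {ω₂ lam β γ : ℝ} (hω : 0 < ω₂) (hl : 0 ≤ lam) (hβ : 0 < β) (hγ : 0 < γ) (hN : 2 ≤ N)
  {T : ℝ} (hT : 0 < T)
include hω hl hβ hγ hN hT

/-- **The Kundu–Dhar–Narayan identity (fixed `N ≥ 2`, equilibrium kernels).** With `J = Σ_i j_i`,
`g = (γ/2)(p_0² - p_{N-1}²)`, `P_t = transitionKernel N T T t`, `μ_T = gibbsMeasure N T`: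

  `∫_{(0,∞)} ∫ g · (P_s J) dμ_T ds = (∫_{(0,∞)} corr(J,J)(t) dt) / (N - 1)`,

`corr(J,J)(t) = ∫ J (P_t J) dμ_T - μ_T(J)²`. Proof (KDN's "D_l trick", at the level of resolvents): for `λ > 0`,
`∫ g R_λ J dμ_T = -∫ J R_λ g dμ_T` (resolvent detailed balance `pinnedChain_resolvent_detailed_balance`, `g` even,
`J` odd); `g = T² LΨ - J/(N-1)` with the even McLennan potential `Ψ` (`pinnedChain_generator_mclennanPotential`) and
`R_λ(LΨ) = λR_λΨ - Ψ` (`pinnedChain_resolvent_coboundary`), `∫ JΨ dμ_T = 0`, so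
`∫ g R_λ J dμ_T = -T²λ ∫ J R_λΨ dμ_T + ∫ J R_λ J dμ_T/(N-1)`; as `λ → 0` the Abel means give
`∫ g R₀J dμ_T = ∫ J R₀J dμ_T/(N-1)` (`pinnedChain_abs_resolvent_sub_kubo_le`, `pinnedChain_abs_abelMean_sub_le`), and
Fubini (`integral_Ioi_integral_nice_mul_act`) converts both sides. [cite: KunduDharNarayan2009, p. 3] -/
theorem kdn_identity :
    (∫ s in Ioi (0 : ℝ), ∫ x,
        γ / 2 * (x.2 ⟨0, by omega⟩ ^ 2 - x.2 ⟨N - 1, by omega⟩ ^ 2) *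
          (∫ y, (∑ i : Fin N, (pinnedChain ω₂ lam β γ).bondCurrent N i y)
            ∂((pinnedChain ω₂ lam β γ).transitionKernel N T T s.toNNReal x))
        ∂((pinnedChain ω₂ lam β γ).gibbsMeasure N T)) =
      (∫ t in Ioi (0 : ℝ),
        ((∫ z, (∑ i : Fin N, (pinnedChain ω₂ lam β γ).bondCurrent N i z) *
            (∫ y, ∑ i : Fin N, (pinnedChain ω₂ lam β γ).bondCurrent N i y
              ∂((pinnedChain ω₂ lam β γ).transitionKernel N T T t.toNNReal z))
          ∂((pinnedChain ω₂ lam β γ).gibbsMeasure N T)) -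
        (∫ z, ∑ i : Fin N, (pinnedChain ω₂ lam β γ).bondCurrent N i z
            ∂((pinnedChain ω₂ lam β γ).gibbsMeasure N T)) *
          (∫ z, ∑ i : Fin N, (pinnedChain ω₂ lam β γ).bondCurrent N i z
            ∂((pinnedChain ω₂ lam β γ).gibbsMeasure N T)))) / ((N : ℝ) - 1) := by
  set P := pinnedChain ω₂ lam β γ with hP
  set μ := P.gibbsMeasure N T with hμ
  have hN0 : 0 < N := by omega
  haveI : IsProbabilityMeasure μ := pinnedChain_isProbabilityMeasure_gibbsMeasure hω hl hβ.le γ N hT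
  set J : PhaseSpace N → ℝ := fun y => ∑ i : Fin N, P.bondCurrent N i y with hJ
  set gK : PhaseSpace N → ℝ := fun x => γ / 2 * (x.2 ⟨0, by omega⟩ ^ 2 - x.2 ⟨N - 1, by omega⟩ ^ 2) with hgK
  have hN1 : (0 : ℝ) < (N : ℝ) - 1 := by
    have : (2 : ℝ) ≤ N := by exact_mod_cast hN
    linarith
  -- exponent
  set ϑ : ℝ := 1 / T / 4 with hϑdef
  have hT1 : 0 < 1 / T := by positivity
  have hϑ0 : 0 < ϑ := by positivity
  have h2ϑ : 2 * ϑ < 1 / T := by rw [hϑdef]; linarith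
  have hϑ1 : ϑ < 1 / T := by linarith
  -- the observables: continuity, bounds, parity
  have hJc : Continuous J := continuous_totalBondCurrent ω₂ lam β γ N
  obtain ⟨CJ, hCJ0, hJb⟩ : ∃ CJ : ℝ, 0 ≤ CJ ∧ ∀ y, |J y| ≤ CJ * Real.exp (ϑ * P.hamiltonian N y) :=
    ⟨_, by positivity, fun y => pinnedChain_abs_totalCurrent_le hω hl hβ.le N hϑ0 y⟩
  have hgc : Continuous gK := continuous_const.mul
    ((((continuous_apply _).comp continuous_snd).pow 2).sub (((continuous_apply _).comp continuous_snd).pow 2))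
  obtain ⟨Cg, hCg0, hgb⟩ : ∃ Cg : ℝ, 0 ≤ Cg ∧ ∀ y, |gK y| ≤ Cg * Real.exp (ϑ * P.hamiltonian N y) := by
    refine ⟨|γ| / 1 ^ 2 * (2 * Real.exp ϑ / ϑ ^ 2), by positivity, fun y => ?_⟩
    have h := pinnedChain_abs_mclennanSource_le hω hl hβ.le N (γ := γ) (T := 1) hϑ0 ⟨0, by omega⟩ ⟨N - 1, by omega⟩ y
    have e : γ / (2 * (1 : ℝ) ^ 2) = γ / 2 := by norm_num
    rw [e] at h
    exact h
  have hJ0 : ∫ y, J y ∂μ = 0 := integral_totalBondCurrent_gibbsMeasure ω₂ lam β γ N T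
  have hJodd : ∀ z : PhaseSpace N, J (z.1, -z.2) = -J z := totalBondCurrent_neg_momentum P N
  have hgeven : ∀ z : PhaseSpace N, gK (z.1, -z.2) = gK z := fun z => by
    simp only [hgK, Pi.neg_apply, neg_sq]
  -- the McLennan potential `Ψ` and `LΨ = J/((N-1)T²) + g/T²`
  set Ψ : PhaseSpace N → ℝ := fun y => (((N : ℝ) - 1) * T ^ 2)⁻¹ * energyMoment P N y +
    (-(2 * T ^ 2)⁻¹) * P.hamiltonian N y with hΨdef
  have hU : ContDiff ℝ ∞ P.U := pinnedChain_contDiff_U ω₂ lam β γ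
  have hV : ContDiff ℝ ∞ P.V := pinnedChain_contDiff_V ω₂ lam β γ
  have hΨinf : ContDiff ℝ ∞ Ψ := (contDiff_const.mul (contDiff_energyMoment P hU hV N)).add
    (contDiff_const.mul (P.contDiff_hamiltonian hU hV N))
  have hΨ2 : ContDiff ℝ 2 Ψ := hΨinf.of_le (by norm_cast)
  have hΨc : Continuous Ψ := hΨinf.continuous
  set a : ℝ := (((N : ℝ) - 1) * T ^ 2)⁻¹ with hadef
  have hLΨ : ∀ x, P.generator N T T Ψ x = a * J x + T⁻¹ ^ 2 * gK x := fun x => by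
    have h := pinnedChain_generator_mclennanPotential hN T hT.ne' x (ω₂ := ω₂) (lam := lam) (β := β) (γ := γ)
    rw [← hP] at h
    rw [hΨdef, h, hgK, hadef]
    simp only [hJ]
    field_simp
  have hLfun : P.generator N T T Ψ = fun x => a * J x + T⁻¹ ^ 2 * gK x := funext hLΨ
  have hLc : Continuous (P.generator N T T Ψ) := by
    rw [hLfun]; exact (continuous_const.mul hJc).add (continuous_const.mul hgc)
  have hLb : ∀ y, |P.generator N T T Ψ y| ≤ (|a| * CJ + |T⁻¹ ^ 2| * Cg) * Real.exp (ϑ * P.hamiltonian N y) := by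
    intro y
    rw [hLΨ y, add_mul]
    refine (abs_add_le _ _).trans (add_le_add ?_ ?_)
    · rw [abs_mul, mul_assoc]; exact mul_le_mul_of_nonneg_left (hJb y) (abs_nonneg _)
    · rw [abs_mul, mul_assoc]; exact mul_le_mul_of_nonneg_left (hgb y) (abs_nonneg _)
  have hCL0 : 0 ≤ |a| * CJ + |T⁻¹ ^ 2| * Cg := by positivity
  -- `|Ψ| ≤ CΨ e^{ϑH}`
  obtain ⟨CΨ, hCΨ0, hΨb⟩ : ∃ CΨ : ℝ, 0 ≤ CΨ ∧ ∀ y, |Ψ y| ≤ CΨ * Real.exp (ϑ * P.hamiltonian N y) := by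
    refine ⟨(|a| * (2 * N) + |(2 * T ^ 2)⁻¹|) * (2 * Real.exp ϑ / ϑ ^ 2), by positivity, fun y => ?_⟩
    have hH0 : 0 ≤ P.hamiltonian N y := pinnedChain_hamiltonian_nonneg hω.le hl hβ.le γ N y
    have hX := pinnedChain_abs_energyMoment_le hω hl hβ.le N (γ := γ) y
    have hsq := pinnedChain_one_add_hamiltonian_sq_le hω hl hβ.le N (γ := γ) hϑ0 y
    have hH1 : P.hamiltonian N y ≤ (1 + P.hamiltonian N y) ^ 2 := by nlinarith
    have h1 : |Ψ y| ≤ (|a| * (2 * N) + |(2 * T ^ 2)⁻¹|) * P.hamiltonian N y := by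
      rw [hΨdef]; simp only
      refine (abs_add_le _ _).trans ?_
      rw [abs_mul, abs_mul, abs_neg, abs_of_nonneg hH0, add_mul]
      refine add_le_add ?_ le_rfl
      rw [mul_assoc]
      exact mul_le_mul_of_nonneg_left hX (abs_nonneg _)
    calc |Ψ y| ≤ (|a| * (2 * N) + |(2 * T ^ 2)⁻¹|) * P.hamiltonian N y := h1
      _ ≤ (|a| * (2 * N) + |(2 * T ^ 2)⁻¹|) * (1 + P.hamiltonian N y) ^ 2 :=
          mul_le_mul_of_nonneg_left hH1 (by positivity)
      _ ≤ (|a| * (2 * N) + |(2 * T ^ 2)⁻¹|) * ((2 * Real.exp ϑ / ϑ ^ 2) * Real.exp (ϑ * P.hamiltonian N y)) :=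
          mul_le_mul_of_nonneg_left hsq (by positivity)
      _ = _ := by ring
  have hΨeven : ∀ z : PhaseSpace N, Ψ (z.1, -z.2) = Ψ z := fun z => by
    simp only [hΨdef, energyMoment_neg_momentum, P.hamiltonian_neg_momentum]
  -- Harris constants and `e^{2ϑH} ∈ L¹(μ_T)`
  obtain ⟨K, c, hK, hc, hb⟩ := pinnedChain_harris_bound hω hl hβ hγ hN0 hT hϑ0 hϑ1
  set E2 : ℝ := ∫ z, Real.exp (2 * ϑ * P.hamiltonian N z) ∂μ with hE2
  have hE20 : 0 ≤ E2 := integral_nonneg fun z => (Real.exp_pos _).le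
  -- `∫ J Ψ dμ_T = 0`
  have hJΨ : ∫ z, J z * Ψ z ∂μ = 0 := by
    have h := integral_comp_reversal_gibbsMeasure P N T (fun z => J z * Ψ z)
    simp only [hJodd, hΨeven, neg_mul, integral_neg] at h
    linarith
  -- the exact identity at `λ > 0`
  have hE : ∀ lam' : ℝ, 0 < lam' →
      ∫ z, gK z * (∫ t in Ioi (0 : ℝ), Real.exp (-(lam' * t)) * ∫ y, J y ∂(P.transitionKernel N T T t.toNNReal z)) ∂μ =
        -(T ^ 2 * lam') *
            ∫ z, J z * (∫ t in Ioi (0 : ℝ), Real.exp (-(lam' * t)) * ∫ y, Ψ y ∂(P.transitionKernel N T T t.toNNReal z)) ∂μ +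
          ((N : ℝ) - 1)⁻¹ *
            ∫ z, J z * (∫ t in Ioi (0 : ℝ), Real.exp (-(lam' * t)) * ∫ y, J y ∂(P.transitionKernel N T T t.toNNReal z)) ∂μ := by
    intro lam' hlam
    -- detailed balance
    have h1 := pinnedChain_resolvent_detailed_balance hω hl hβ hγ hN hT hϑ0 h2ϑ hgc hJc hCg0 hCJ0 hgb hJb hlam
    simp only [hgeven, hJodd, mul_neg, integral_neg] at h1
    -- decomposition of the source
    have hgfun : gK = fun y => T ^ 2 * P.generator N T T Ψ y - ((N : ℝ) - 1)⁻¹ * J y := by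
      funext y; rw [hLΨ y, hadef]; field_simp; ring
    have hf1c : Continuous fun y => T ^ 2 * P.generator N T T Ψ y := continuous_const.mul hLc
    have hf2c : Continuous fun y => ((N : ℝ) - 1)⁻¹ * J y := continuous_const.mul hJc
    have hf1b := abs_const_mul_le_exp_bound (T ^ 2) hLb
    have hf2b := abs_const_mul_le_exp_bound ((N : ℝ) - 1)⁻¹ hJb
    have h2 : ∀ z, (∫ t in Ioi (0 : ℝ), Real.exp (-(lam' * t)) * ∫ y, gK y ∂(P.transitionKernel N T T t.toNNReal z)) =
        T ^ 2 * (∫ t in Ioi (0 : ℝ), Real.exp (-(lam' * t)) *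
            ∫ y, P.generator N T T Ψ y ∂(P.transitionKernel N T T t.toNNReal z)) -
          ((N : ℝ) - 1)⁻¹ * (∫ t in Ioi (0 : ℝ), Real.exp (-(lam' * t)) *
            ∫ y, J y ∂(P.transitionKernel N T T t.toNNReal z)) := by
      intro z
      rw [hgfun, pinnedChain_resolvent_sub hω hl hβ hγ hN0 hT hϑ0 hϑ1 hf1c hf2c (by positivity) (by positivity)
        hf1b hf2b hlam z, pinnedChain_resolvent_const_mul, pinnedChain_resolvent_const_mul]
    -- coboundary
    have h3 := pinnedChain_resolvent_coboundary hω hl hβ hγ hN hT hϑ0 h2ϑ hΨ2 hCΨ0 hCL0 hΨb hLb hlam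
    have hI1 := integrable_nice_mul_resolvent hω hl hβ hγ hT hN0 hϑ0 h2ϑ hJc hLc hCL0 hJb hLb hlam
    have hI2 := integrable_nice_mul_resolvent hω hl hβ hγ hT hN0 hϑ0 h2ϑ hJc hJc hCJ0 hJb hJb hlam
    have hI3 := integrable_nice_mul_resolvent hω hl hβ hγ hT hN0 hϑ0 h2ϑ hJc hΨc hCΨ0 hJb hΨb hlam
    have hI4 : Integrable (fun z => J z * Ψ z) μ :=
      (integrable_nice_mul_of_abs_le_exp hω hl hβ hT h2ϑ hJc hΨc.stronglyMeasurable hJb hΨb).1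
    have h4 : ∫ z, J z * (∫ t in Ioi (0 : ℝ), Real.exp (-(lam' * t)) *
        ∫ y, P.generator N T T Ψ y ∂(P.transitionKernel N T T t.toNNReal z)) ∂μ =
        lam' * ∫ z, J z * (∫ t in Ioi (0 : ℝ), Real.exp (-(lam' * t)) *
          ∫ y, Ψ y ∂(P.transitionKernel N T T t.toNNReal z)) ∂μ := by
      have e : ∫ z, J z * (∫ t in Ioi (0 : ℝ), Real.exp (-(lam' * t)) *
          ∫ y, P.generator N T T Ψ y ∂(P.transitionKernel N T T t.toNNReal z)) ∂μ =
          ∫ z, (lam' * (J z * (∫ t in Ioi (0 : ℝ), Real.exp (-(lam' * t)) *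
            ∫ y, Ψ y ∂(P.transitionKernel N T T t.toNNReal z))) - J z * Ψ z) ∂μ := by
        refine integral_congr_ae (h3.mono fun z hz => ?_)
        simp only at hz ⊢
        rw [hz]; ring
      rw [e, integral_sub (hI3.const_mul _) hI4, integral_const_mul, hJΨ, sub_zero]
    -- assemble
    have h5 : ∫ z, J z * (∫ t in Ioi (0 : ℝ), Real.exp (-(lam' * t)) * ∫ y, gK y ∂(P.transitionKernel N T T t.toNNReal z)) ∂μ =
        T ^ 2 * (lam' * ∫ z, J z * (∫ t in Ioi (0 : ℝ), Real.exp (-(lam' * t)) *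
            ∫ y, Ψ y ∂(P.transitionKernel N T T t.toNNReal z)) ∂μ) -
          ((N : ℝ) - 1)⁻¹ * ∫ z, J z * (∫ t in Ioi (0 : ℝ), Real.exp (-(lam' * t)) *
            ∫ y, J y ∂(P.transitionKernel N T T t.toNNReal z)) ∂μ := by
      simp_rw [h2]
      have e : (fun z => J z * (T ^ 2 * (∫ t in Ioi (0 : ℝ), Real.exp (-(lam' * t)) *
            ∫ y, P.generator N T T Ψ y ∂(P.transitionKernel N T T t.toNNReal z)) -
          ((N : ℝ) - 1)⁻¹ * (∫ t in Ioi (0 : ℝ), Real.exp (-(lam' * t)) * ∫ y, J y ∂(P.transitionKernel N T T t.toNNReal z)))) =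
          fun z => T ^ 2 * (J z * (∫ t in Ioi (0 : ℝ), Real.exp (-(lam' * t)) *
            ∫ y, P.generator N T T Ψ y ∂(P.transitionKernel N T T t.toNNReal z))) -
          ((N : ℝ) - 1)⁻¹ * (J z * (∫ t in Ioi (0 : ℝ), Real.exp (-(lam' * t)) *
            ∫ y, J y ∂(P.transitionKernel N T T t.toNNReal z))) := by
        funext z; ring
      rw [e, integral_sub (hI1.const_mul _) (hI2.const_mul _), integral_const_mul, integral_const_mul, h4]
    have hcomm : ∫ z, (∫ t in Ioi (0 : ℝ), Real.exp (-(lam' * t)) * ∫ y, gK y ∂(P.transitionKernel N T T t.toNNReal z)) * J z ∂μ =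
        ∫ z, J z * (∫ t in Ioi (0 : ℝ), Real.exp (-(lam' * t)) * ∫ y, gK y ∂(P.transitionKernel N T T t.toNNReal z)) ∂μ :=
      integral_congr_ae (Eventually.of_forall fun z => mul_comm _ _)
    rw [h1, hcomm, h5]
    ring
  -- the Kubo integrals `R₀J`: measurability and bounds
  have hR0m : StronglyMeasurable fun z => ∫ t in Ioi (0 : ℝ), ∫ y, J y ∂(P.transitionKernel N T T t.toNNReal z) :=
    pinnedChain_stronglyMeasurable_kubo hω hl hβ.le hγ.le T T hJc.measurable
  have hR0b := pinnedChain_abs_kubo_le hω hl hβ hγ hb hc hJc hCJ0 hJb hJ0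
  have hRm : ∀ (lam' : ℝ) (f : PhaseSpace N → ℝ), Continuous f → StronglyMeasurable fun z =>
      ∫ t in Ioi (0 : ℝ), Real.exp (-(lam' * t)) * ∫ y, f y ∂(P.transitionKernel N T T t.toNNReal z) :=
    fun lam' f hf => pinnedChain_stronglyMeasurable_resolvent hω hl hβ.le hγ.le T T hf.measurable lam'
  -- the three `O(λ)` estimates
  have hD : ∀ lam' : ℝ, 0 < lam' →
      |(∫ z, gK z * (∫ t in Ioi (0 : ℝ), ∫ y, J y ∂(P.transitionKernel N T T t.toNNReal z)) ∂μ) -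
        ((N : ℝ) - 1)⁻¹ * ∫ z, J z * (∫ t in Ioi (0 : ℝ), ∫ y, J y ∂(P.transitionKernel N T T t.toNNReal z)) ∂μ| ≤
        (Cg * (K * CJ / c ^ 2) * E2 + T ^ 2 * (CJ * (K * CΨ / c) * E2) +
          ((N : ℝ) - 1)⁻¹ * (CJ * (K * CJ / c ^ 2) * E2)) * lam' := by
    intro lam' hlam
    -- d1: gK against `R_λ J - R₀ J`
    have hW1b : ∀ z, |(∫ t in Ioi (0 : ℝ), Real.exp (-(lam' * t)) * ∫ y, J y ∂(P.transitionKernel N T T t.toNNReal z)) -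
        ∫ t in Ioi (0 : ℝ), ∫ y, J y ∂(P.transitionKernel N T T t.toNNReal z)| ≤
        lam' * (K * CJ / c ^ 2) * Real.exp (ϑ * P.hamiltonian N z) := fun z =>
      (pinnedChain_abs_resolvent_sub_kubo_le hω hl hβ hγ hϑ0 hb hc hJc hCJ0 hJb hJ0 hlam z).trans_eq (by ring)
    have d1 := integrable_nice_mul_of_abs_le_exp hω hl hβ hT h2ϑ hgc ((hRm lam' J hJc).sub hR0m) hgb hW1b
    have d2 := integrable_nice_mul_of_abs_le_exp hω hl hβ hT h2ϑ hJc ((hRm lam' J hJc).sub hR0m) hJb hW1b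
    -- d3: the Abel mean of `Ψ`
    have hW3b : ∀ z, |lam' * (∫ t in Ioi (0 : ℝ), Real.exp (-(lam' * t)) * ∫ y, Ψ y ∂(P.transitionKernel N T T t.toNNReal z)) -
        ∫ y, Ψ y ∂μ| ≤ lam' * (K * CΨ / c) * Real.exp (ϑ * P.hamiltonian N z) := fun z =>
      (pinnedChain_abs_abelMean_sub_le hω hl hβ hγ hϑ0 hb hc hΨc hCΨ0 hΨb hlam z).trans_eq (by ring)
    have d3 := integrable_nice_mul_of_abs_le_exp hω hl hβ hT h2ϑ hJc
      (((hRm lam' Ψ hΨc).const_mul lam').sub stronglyMeasurable_const) hJb hW3b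
    -- integrability of the individual pairings
    have iG1 := integrable_nice_mul_resolvent hω hl hβ hγ hT hN0 hϑ0 h2ϑ hgc hJc hCJ0 hgb hJb hlam
    have iG0 := (integrable_nice_mul_of_abs_le_exp hω hl hβ hT h2ϑ hgc hR0m hgb (D := K * CJ / c)
      (fun z => (hR0b z).trans_eq (by ring))).1
    have iJ1 := integrable_nice_mul_resolvent hω hl hβ hγ hT hN0 hϑ0 h2ϑ hJc hJc hCJ0 hJb hJb hlam
    have iJ0 := (integrable_nice_mul_of_abs_le_exp hω hl hβ hT h2ϑ hJc hR0m hJb (D := K * CJ / c)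
      (fun z => (hR0b z).trans_eq (by ring))).1
    have iJΨ := integrable_nice_mul_resolvent hω hl hβ hγ hT hN0 hϑ0 h2ϑ hJc hΨc hCΨ0 hJb hΨb hlam
    -- rewrite the three differences as single integrals
    have e1 : (∫ z, gK z * (∫ t in Ioi (0 : ℝ), Real.exp (-(lam' * t)) * ∫ y, J y ∂(P.transitionKernel N T T t.toNNReal z)) ∂μ) -
        ∫ z, gK z * (∫ t in Ioi (0 : ℝ), ∫ y, J y ∂(P.transitionKernel N T T t.toNNReal z)) ∂μ =
        ∫ z, gK z * ((∫ t in Ioi (0 : ℝ), Real.exp (-(lam' * t)) * ∫ y, J y ∂(P.transitionKernel N T T t.toNNReal z)) -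
          ∫ t in Ioi (0 : ℝ), ∫ y, J y ∂(P.transitionKernel N T T t.toNNReal z)) ∂μ := by
      rw [← integral_sub iG1 iG0]
      exact integral_congr_ae (Eventually.of_forall fun z => by ring)
    have e2 : (∫ z, J z * (∫ t in Ioi (0 : ℝ), Real.exp (-(lam' * t)) * ∫ y, J y ∂(P.transitionKernel N T T t.toNNReal z)) ∂μ) -
        ∫ z, J z * (∫ t in Ioi (0 : ℝ), ∫ y, J y ∂(P.transitionKernel N T T t.toNNReal z)) ∂μ =
        ∫ z, J z * ((∫ t in Ioi (0 : ℝ), Real.exp (-(lam' * t)) * ∫ y, J y ∂(P.transitionKernel N T T t.toNNReal z)) -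
          ∫ t in Ioi (0 : ℝ), ∫ y, J y ∂(P.transitionKernel N T T t.toNNReal z)) ∂μ := by
      rw [← integral_sub iJ1 iJ0]
      exact integral_congr_ae (Eventually.of_forall fun z => by ring)
    have hexp1 := pinnedChain_integrable_exp_mul_hamiltonian_gibbsMeasure hω hl hβ.le γ N hT hϑ1
    have iJ : Integrable J μ := (hexp1.const_mul CJ).mono' hJc.aestronglyMeasurable
      (Eventually.of_forall fun z => by rw [Real.norm_eq_abs]; exact hJb z)
    have e3 : lam' * ∫ z, J z * (∫ t in Ioi (0 : ℝ), Real.exp (-(lam' * t)) * ∫ y, Ψ y ∂(P.transitionKernel N T T t.toNNReal z)) ∂μ =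
        ∫ z, J z * (lam' * (∫ t in Ioi (0 : ℝ), Real.exp (-(lam' * t)) * ∫ y, Ψ y ∂(P.transitionKernel N T T t.toNNReal z)) -
          ∫ y, Ψ y ∂μ) ∂μ := by
      have e : (fun z => J z * (lam' * (∫ t in Ioi (0 : ℝ), Real.exp (-(lam' * t)) *
          ∫ y, Ψ y ∂(P.transitionKernel N T T t.toNNReal z)) - ∫ y, Ψ y ∂μ)) =
          fun z => lam' * (J z * (∫ t in Ioi (0 : ℝ), Real.exp (-(lam' * t)) *
            ∫ y, Ψ y ∂(P.transitionKernel N T T t.toNNReal z))) - (∫ y, Ψ y ∂μ) * J z := by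
        funext z; ring
      rw [e, integral_sub (iJΨ.const_mul _) (iJ.const_mul _), integral_const_mul, integral_const_mul, hJ0,
        mul_zero, sub_zero]
    -- combine
    have hEl := hE lam' hlam
    set G0 := ∫ z, gK z * (∫ t in Ioi (0 : ℝ), ∫ y, J y ∂(P.transitionKernel N T T t.toNNReal z)) ∂μ with hG0
    set G1 := ∫ z, gK z * (∫ t in Ioi (0 : ℝ), Real.exp (-(lam' * t)) * ∫ y, J y ∂(P.transitionKernel N T T t.toNNReal z)) ∂μ
      with hG1
    set J0p := ∫ z, J z * (∫ t in Ioi (0 : ℝ), ∫ y, J y ∂(P.transitionKernel N T T t.toNNReal z)) ∂μ with hJ0p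
    set J1 := ∫ z, J z * (∫ t in Ioi (0 : ℝ), Real.exp (-(lam' * t)) * ∫ y, J y ∂(P.transitionKernel N T T t.toNNReal z)) ∂μ
      with hJ1
    set A1 := ∫ z, J z * (∫ t in Ioi (0 : ℝ), Real.exp (-(lam' * t)) * ∫ y, Ψ y ∂(P.transitionKernel N T T t.toNNReal z)) ∂μ
      with hA1
    have hDeq : G0 - ((N : ℝ) - 1)⁻¹ * J0p = -(G1 - G0) - T ^ 2 * (lam' * A1) + ((N : ℝ) - 1)⁻¹ * (J1 - J0p) := by
      rw [hEl]; ring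
    have b1 : |G1 - G0| ≤ Cg * (lam' * (K * CJ / c ^ 2)) * E2 := by rw [e1]; exact d1.2
    have b2 : |J1 - J0p| ≤ CJ * (lam' * (K * CJ / c ^ 2)) * E2 := by rw [e2]; exact d2.2
    have b3 : |lam' * A1| ≤ CJ * (lam' * (K * CΨ / c)) * E2 := by rw [e3]; exact d3.2
    have hNi : 0 ≤ ((N : ℝ) - 1)⁻¹ := inv_nonneg.2 hN1.le
    rw [hDeq]
    calc |-(G1 - G0) - T ^ 2 * (lam' * A1) + ((N : ℝ) - 1)⁻¹ * (J1 - J0p)|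
        ≤ |-(G1 - G0) - T ^ 2 * (lam' * A1)| + |((N : ℝ) - 1)⁻¹ * (J1 - J0p)| := abs_add_le _ _
      _ ≤ (|-(G1 - G0)| + |T ^ 2 * (lam' * A1)|) + |((N : ℝ) - 1)⁻¹ * (J1 - J0p)| :=
          add_le_add_left (abs_sub _ _) _
      _ = |G1 - G0| + T ^ 2 * |lam' * A1| + ((N : ℝ) - 1)⁻¹ * |J1 - J0p| := by
          rw [abs_neg, abs_mul (T ^ 2) (lam' * A1), abs_mul ((N : ℝ) - 1)⁻¹ (J1 - J0p),
            abs_of_nonneg (by positivity : (0 : ℝ) ≤ T ^ 2), abs_of_nonneg hNi]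
      _ ≤ Cg * (lam' * (K * CJ / c ^ 2)) * E2 + T ^ 2 * (CJ * (lam' * (K * CΨ / c)) * E2) +
            ((N : ℝ) - 1)⁻¹ * (CJ * (lam' * (K * CJ / c ^ 2)) * E2) := by
          gcongr
      _ = _ := by ring
  have hD0 : (∫ z, gK z * (∫ t in Ioi (0 : ℝ), ∫ y, J y ∂(P.transitionKernel N T T t.toNNReal z)) ∂μ) -
      ((N : ℝ) - 1)⁻¹ * ∫ z, J z * (∫ t in Ioi (0 : ℝ), ∫ y, J y ∂(P.transitionKernel N T T t.toNNReal z)) ∂μ = 0 :=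
    eq_zero_of_abs_le_mul_eps fun ε hε => hD ε hε
  -- Fubini on both sides
  have hFg := integral_Ioi_integral_nice_mul_act hω hl hβ hγ hN0 hT hϑ0 h2ϑ hgc hJc hCJ0 hgb hJb hJ0
  have hFJ := integral_Ioi_integral_nice_mul_act hω hl hβ hγ hN0 hT hϑ0 h2ϑ hJc hJc hCJ0 hJb hJb hJ0
  simp_rw [hJ0, mul_zero, sub_zero]
  rw [hFg, hFJ]
  have h := hD0
  rw [sub_eq_zero] at h
  have key : ∀ X Y : ℝ, X = ((N : ℝ) - 1)⁻¹ * Y → X = Y / ((N : ℝ) - 1) := fun X Y hXY => by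
    rw [hXY]; field_simp
  exact key _ _ h

end KDN

end Summit.AtomisticToContinuum.FouriersLaw.Theorems.OpenChainGreenKubo

end
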